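import Summits.CriticalPhenomena.PercolationContinuityZ3.Theorems.Transplant.FKConnectivityAllQCountReweightedFourPoint
import Summits.CriticalPhenomena.PercolationContinuityZ3.Theorems.Transplant.FKConnectivityAllQCondClusterDomCex
import HarnessLib

/-!
# Count-reweighted measures along an embedding (idle vertices shift the count weight) and the RIGIDITY theorem:
# hub ∧ four-point on all finite weighted graphs force a geometric count weight from level 2 on

Support file (`--supports stmt-CriticalPhenomena-4575`), FK sub-lane `prim-bschramm-fk-1` (gen 11) of the post-continuity programme;
builds on p205010 (kernel theorem, internal audit signed; external expert review pending).  No definitions, no named facts, no sorries;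
standard axioms.  Nothing here bears on p205010.

* **`crMeasure_real_image`** — TRANSPORT for `μ_{w,h} ∝ P_w·h(k)`: for an injection `j : V ↪ U` of finite vertex types and parameters `w'`
  on `Sym2 U` vanishing off the range of `Sym2.map j`, `μ_{w',h}(A) = μ_{w'∘j, h(· + d)}({ω | j ω ∈ A})` with `d = #(U ∖ j V)` idle vertices
  (each an isolated cluster: `card_connectedComponent_image_eq_add`).  The count-weight analogue of the fk-continuity cell's
  `rcMeasureW_real_preimage_image_sym2Map` (where the shift is the factor `q^d`).
* **`fourPointUnder_image_iff`** — the four-point inequality at `(j o; j a, j c; j b)` under `μ_{w',h}` is the four-point inequality at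
  `(o; a, c; b)` under `μ_{w'∘j, h(·+d)}`.
* **`logConcave_of_fourPoint_all`** — if the four-point inequality holds under `μ_h` on every finite weighted graph (all `Fin n`), then
  `h(m−1)·h(m+1) ≤ h(m)²` for EVERY `m ≥ 3` (the 6-cycle `fourPoint_c6_iff` padded with `m − 3` idle vertices).
* **`geometric_of_hub_and_fourPoint_all`** — RIGIDITY: if both the hub inequality (fk-1 g10: forces `h(m)² ≤ h(m−1)h(m+1)`, `m ≥ 2`) and
  the four-point inequality hold under `μ_h` on all finite weighted graphs, then `h(m)² = h(m−1)·h(m+1)` for all `m ≥ 3`, i.e.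
  `h(k) = h(2)·r^{k−2}` for `k ≥ 2` with `r = h(3)/h(2)`: up to the free weight of the single-cluster level `k = 1`, the only cluster-count
  reweightings of product measure compatible with both product-form links of the Kozma–Nitzan chain are the random-cluster measures.
[cite: Grimmett2006, §1.4 eq. (1.20) (p. 15); Lemma (4.13) (p. 71); §3.9 (pp. 63–65)] [cite: KozmaNitzan2024, Thm. 1 (p. 7)]
[cite: AyyerLinussonRavichandran2025, §7 eq. (15) (p. 22)]
-/

noncomputable section

namespace Summit.CriticalPhenomena.PercolationContinuityZ3.Theorems

namespace FK

open MeasureTheory Set Literature.Probability.LatticeModels Literature.Probability.Percolation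
open Literature.Probability.Percolation.BHK2006 (weight)
open Literature.Probability.Percolation.DecisionTree (ind ind_of_mem ind_of_not_mem)
open scoped Classical

/-! ### Transport of count-reweighted measures along an embedding -/

section Transport

variable {V U : Type*} [Fintype V] [Fintype U] (j : V ↪ U) (w' : Sym2 U → unitInterval)
  (hw' : ∀ e, e ∉ Set.range (Sym2.map j) → w' e = 0)
include hw'

/-- **Count-reweighted weights along an embedding**: `crWeight w' h (j ω) = crWeight (w'∘j) (h(· + d)) ω`, `d` = number of idle vertices
(they are isolated clusters). [cite: Grimmett2006, §1.4 eq. (1.20) (p. 15); §4.2] -/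
theorem crWeight_image_sym2Map (h : ℕ → ℝ) (ω : BondConfig V) :
    crWeight w' h (Sym2.map j '' ω) =
      crWeight (fun e => w' (Sym2.map j e)) (fun k => h (k + Nat.card {u : U // u ∉ Set.range j})) ω := by
  unfold crWeight clusterCount
  rw [weight_image_sym2Map j w' hw' ω]
  have hk := card_connectedComponent_image_eq_add j ω (∅ : Set V)
  simp only [wiredOpenGraph, Set.image_empty] at hk
  rw [hk]

omit [Fintype V] in
/-- A configuration of `U` using a pair off the range has product weight `0`. [cite: Grimmett2006, §1.4 eq. (1.20) (p. 15)] -/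
theorem weight_eq_zero_of_not_subset_range {S : BondConfig U} (hS : ¬ S ⊆ Set.range (Sym2.map j)) :
    weight (fun e => (w' e : ℝ)) S = 0 := by
  obtain ⟨e, heS, he⟩ := Set.not_subset.1 hS
  unfold weight
  exact Finset.prod_eq_zero (Finset.mem_univ e) (by rw [if_pos heS]; simp [hw' e he])

/-- **Sums against count-reweighted weights along an embedding**: only image configurations contribute, and on them the weight is the
pulled-back weight with the shifted count weight. [cite: Grimmett2006, §1.4 eq. (1.20) (p. 15)] -/
theorem sum_crWeight_image (h : ℕ → ℝ) (f : BondConfig U → ℝ) :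
    ∑ S : BondConfig U, crWeight w' h S * f S =
      ∑ ω : BondConfig V, crWeight (fun e => w' (Sym2.map j e)) (fun k => h (k + Nat.card {u : U // u ∉ Set.range j})) ω *
        f (Sym2.map j '' ω) := by
  have h1 : ∑ S ∈ (Finset.univ : Finset (BondConfig V)).image (fun ω => Sym2.map j '' ω), crWeight w' h S * f S =
      ∑ S, crWeight w' h S * f S := by
    refine Finset.sum_subset (Finset.subset_univ _) fun S _ hS => ?_
    have hsub : ¬ S ⊆ Set.range (Sym2.map j) := fun hsub =>
      hS (Finset.mem_image.2 ⟨Sym2.map j ⁻¹' S, Finset.mem_univ _, (eq_image_preimage_of_subset_range j hsub).symm⟩)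
    unfold crWeight
    rw [weight_eq_zero_of_not_subset_range j w' hw' hsub, zero_mul, zero_mul]
  rw [← h1, Finset.sum_image fun ω₁ _ ω₂ _ h => image_sym2Map_injective j h]
  exact Finset.sum_congr rfl fun ω _ => by rw [crWeight_image_sym2Map j w' hw' h ω]

/-- **Count-reweighted measures along an embedding** ('idle vertices shift the count weight'): for `h > 0`,
`μ_{w',h}(A) = μ_{w'∘j, h(·+d)}({ω | j ω ∈ A})`. [cite: Grimmett2006, Lemma (4.13) (p. 71); §1.4 eq. (1.20) (p. 15)] -/
theorem crMeasure_real_image {h : ℕ → ℝ} (hpos : ∀ k, 0 < h k) (A : Set (BondConfig U)) :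
    (crMeasure w' h).real A =
      (crMeasure (fun e => w' (Sym2.map j e)) (fun k => h (k + Nat.card {u : U // u ∉ Set.range j}))).real
        {ω : BondConfig V | Sym2.map j '' ω ∈ A} := by
  have hpos' : ∀ k, 0 < h (k + Nat.card {u : U // u ∉ Set.range j}) := fun k => hpos _
  rw [crMeasure_real_eq_sum_div w' hpos A, crMeasure_real_eq_sum_div _ hpos']
  unfold crPartition
  rw [sum_crWeight_image j w' hw' h (fun S => ind A S)]
  have hZ := sum_crWeight_image j w' hw' h (fun _ => 1)
  simp only [mul_one] at hZ
  rw [hZ]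
  rfl

omit [Fintype V] [Fintype U] hw' in
/-- The pattern events pull back along the embedding. [cite: Grimmett2006, §4.3 (automorphism invariance)] -/
theorem preimage_pattern (x y u v s t : V) :
    {ω : BondConfig V | Sym2.map j '' ω ∈ openConn (j x) (j y) ∩ openConn (j u) (j v) ∩ (sepEv (j s) (j t) : Set (BondConfig U))} =
      openConn x y ∩ openConn u v ∩ (sepEv s t : Set (BondConfig V)) := by
  ext ω
  simp only [mem_setOf_eq, mem_inter_iff, mem_sepEv_iff, image_mem_openConn_iff, reachable_image_iff]

/-- **The four-point inequality along an embedding**: at `(j o; j a, j c; j b)` under `μ_{w',h}` it is the four-point inequality at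
`(o; a, c; b)` under `μ_{w'∘j, h(·+d)}`. [cite: KozmaNitzan2024, Thm. 1 (p. 7)] [cite: Grimmett2006, Lemma (4.13) (p. 71)] -/
theorem fourPointUnder_image_iff {h : ℕ → ℝ} (hpos : ∀ k, 0 < h k) (o a c b : V) :
    FourPointUnder (crMeasure w' h) (j o) (j a) (j c) (j b) ↔
      FourPointUnder (crMeasure (fun e => w' (Sym2.map j e)) (fun k => h (k + Nat.card {u : U // u ∉ Set.range j}))) o a c b := by
  unfold FourPointUnder
  simp only [crMeasure_real_image j w' hw' hpos, preimage_pattern]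

end Transport

/-! ### Log-concavity at every level is necessary for the four-point inequality; rigidity -/

/-- The number of idle vertices of `Fin.castAddEmb i : Fin n ↪ Fin (n + i)` is `i`. [folklore] -/
theorem card_idle_castAddEmb (n i : ℕ) : Nat.card {u : Fin (n + i) // u ∉ Set.range (Fin.castAddEmb i : Fin n ↪ Fin (n + i))} = i := by
  rw [Nat.card_eq_fintype_card, Fintype.card_subtype_compl, Fintype.card_fin]
  have : Fintype.card {u : Fin (n + i) // u ∈ Set.range (Fin.castAddEmb i : Fin n ↪ Fin (n + i))} = n := by
    rw [Fintype.card_subtype, show (Finset.univ.filter fun u : Fin (n + i) => u ∈ Set.range (Fin.castAddEmb i : Fin n ↪ Fin (n + i))) =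
      Finset.univ.map (Fin.castAddEmb i) from ?_, Finset.card_map, Finset.card_univ, Fintype.card_fin]
    ext u
    simp [Set.mem_range, eq_comm]
  omega

open FourPointC6 in
/-- **Log-concavity at EVERY level `m ≥ 3` is necessary for the four-point inequality on all finite weighted graphs**: pad the 6-cycle
with `m − 3` idle vertices (`crMeasure_real_image` shifts the count weight by `m − 3`) and apply `fourPoint_c6_iff`.
[cite: KozmaNitzan2024, Thm. 1 (p. 7)] [cite: Grimmett2006, §3.9 (pp. 63–65)] -/
theorem logConcave_of_fourPoint_all {h : ℕ → ℝ} (hpos : ∀ k, 0 < h k)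
    (hfp : ∀ (n : ℕ) (w : Sym2 (Fin n) → unitInterval) (o a c b : Fin n), FourPointUnder (crMeasure w h) o a c b)
    {m : ℕ} (hm : 3 ≤ m) : h (m - 1) * h (m + 1) ≤ h m ^ 2 := by
  obtain ⟨i, rfl⟩ : ∃ i, m = 3 + i := ⟨m - 3, by omega⟩
  set j : Fin 6 ↪ Fin (6 + i) := Fin.castAddEmb i with hj
  set w' : Sym2 (Fin (6 + i)) → unitInterval := Function.extend (Sym2.map j) c6.w 0 with hw'
  have hvan : ∀ e, e ∉ Set.range (Sym2.map j) → w' e = 0 := fun e he => extend_sym2Map_eq_zero j _ he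
  have hcomp : (fun e => w' (Sym2.map j e)) = c6.w := funext fun e => extend_sym2Map_apply j _ e
  have key := (fourPointUnder_image_iff j w' hvan hpos 0 1 2 3).1 (hfp (6 + i) w' (j 0) (j 1) (j 2) (j 3))
  rw [hcomp, hj, card_idle_castAddEmb] at key
  have hc := (fourPoint_c6_iff (h := fun k => h (k + i)) (fun k => hpos _)).1 key
  have e1 : 3 + i - 1 = 2 + i := by omega
  have e2 : 3 + i + 1 = 4 + i := by omega
  rw [e1, e2]
  simpa using hc

/-- **RIGIDITY**: if both the hub inequality and the four-point inequality hold under `μ_h` on ALL finite weighted graphs, then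
`h(m)² = h(m−1)·h(m+1)` for every `m ≥ 3` (log-convex from the hub on paths, fk-1 g10's `logConvex_of_hub_all`; log-concave from the
four-point inequality on padded 6-cycles). [cite: AyyerLinussonRavichandran2025, §7 eq. (15) (p. 22)] [cite: KozmaNitzan2024, Thm. 1 (p. 7)] -/
theorem logLinear_of_hub_and_fourPoint_all {h : ℕ → ℝ} (hpos : ∀ k, 0 < h k)
    (hhub : ∀ (n : ℕ) (w : Sym2 (Fin n) → unitInterval) (o a b : Fin n), HubUnder (crMeasure w h) o a b)
    (hfp : ∀ (n : ℕ) (w : Sym2 (Fin n) → unitInterval) (o a c b : Fin n), FourPointUnder (crMeasure w h) o a c b)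
    {m : ℕ} (hm : 3 ≤ m) : h m ^ 2 = h (m - 1) * h (m + 1) := by
  have h1 := logConvex_of_hub_all hpos hhub (m := m) (by omega)
  have h2 := logConcave_of_fourPoint_all hpos hfp hm
  nlinarith [h1, h2]

/-- **RIGIDITY, closed form**: under the hypotheses of `logLinear_of_hub_and_fourPoint_all`, `h(k) = h(2)·r^{k−2}` for all `k ≥ 2` with
`r = h(3)/h(2)` — a random-cluster weight `q^k` (`q = r`) up to a constant and up to the free weight of the one-cluster level `k = 1`.
[cite: Grimmett2006, §1.4 eq. (1.20) (p. 15); §3.9 (pp. 63–65)] [cite: KozmaNitzan2024, Thm. 1 (p. 7)] -/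
theorem geometric_of_hub_and_fourPoint_all {h : ℕ → ℝ} (hpos : ∀ k, 0 < h k)
    (hhub : ∀ (n : ℕ) (w : Sym2 (Fin n) → unitInterval) (o a b : Fin n), HubUnder (crMeasure w h) o a b)
    (hfp : ∀ (n : ℕ) (w : Sym2 (Fin n) → unitInterval) (o a c b : Fin n), FourPointUnder (crMeasure w h) o a c b)
    (k : ℕ) (hk : 2 ≤ k) : h k = h 2 * (h 3 / h 2) ^ (k - 2) := by
  -- induction on `k ≥ 2` using `h(m+1) = h(m)²/h(m−1)`, i.e. constant ratio
  have ratio : ∀ m, 2 ≤ m → h (m + 1) / h m = h 3 / h 2 := by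
    intro m hm
    induction m with
    | zero => omega
    | succ m ih =>
      rcases Nat.lt_or_ge m 2 with hlt | hge
      · interval_cases m
        · omega
        · norm_num
      · have hll := logLinear_of_hub_and_fourPoint_all hpos hhub hfp (m := m + 1) (by omega)
        simp only [Nat.add_sub_cancel] at hll
        have hm0 := hpos m
        have hm1 := hpos (m + 1)
        rw [← ih hge]
        field_simp
        nlinarith [hll]
  induction k with
  | zero => omega
  | succ k ih =>
    rcases Nat.lt_or_ge k 2 with hlt | hge
    · interval_cases k
      · omega
      · simp
    · have hr := ratio k hge
      have hk0 := hpos k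
      rw [show k + 1 - 2 = (k - 2) + 1 by omega, pow_succ, ← mul_assoc, ← ih hge, ← hr]
      field_simp

end FK

end Summit.CriticalPhenomena.PercolationContinuityZ3.Theorems

end
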